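import Summits.BirchSwinnertonDyer.Uniform.U2.CubicFieldInertOddTrace
import Summits.BirchSwinnertonDyer.BirchSwinnertonDyer.Theorems.TwoAdicConverseFrobeniusParityTwoDivisionRoot
import HarnessLib

/-!
# Route `AlignedTransportAtTwo`, crux C2 `MainConjectureOfRankZeroBSDAtTwo` (stmt-22298), line `birth` — THE ZHAI DICTIONARY IS AN EQUIVALENCE:
# «`q` inert in the cubic `2`-division field `F`» ⟺ «`a_q(W)` odd» at every odd good prime `q` (for `E(ℚ)[2] = 0`)

HONEST FRAMING (cell `bsd-f1-sign2`, WIDTH-5 attach seat `bsd-line-att-p4` g24; `--supports stmt-BirchSwinnertonDyer-22298 --as helper`).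
THEOREMS ONLY (no `def`, no named fact, no `sorry`). Elementary algebraic number theory of the cubic field of the `2`-division polynomial;
no claim about BSD; nothing closed; C2's verdict untouched. BSD is NOT proved.

WHY. Zhai 2016 Thms. 1.1/1.2 (tree: `Zhai2016.thm11_ordTwo_LAlg_twist_eq_zero'` …) are printed for twisting primes «inert in the field `F`
obtained by adjoining one root of the `2`-division polynomial» (`Zhai2016.IsInertIn F q`), whereas the cell's class condition, LMFDB's column and
cell `bsd-uniform`'s transport theorems (`U2.bsdp_two_twist_of_rankZero_base…`, consumed by this lineage's `…TwistFamilyZhaiTransport`) use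
«`a_q(W)` odd». `U2.CubicFieldInertOddTrace` (cell `bsd-uniform`, INGREDIENTS F9) PROVED `a_q` odd ⟹ `q` inert and recorded the converse as
needing Dedekind–Kummer for the `2`-division cubic (index condition `q ∤ [𝓞_F : ℤ[η]]`), so the two binders `hin` / `hodd` have been carried
side by side (`U2.bsdp_two_twist_of_zhai11_boxerDiao_of_odd_frobeniusTrace`; g23's `IsInertIn`-form rows vs g24's `a_q`-odd-form rows).
THIS FILE PROVES THE CONVERSE with no index hypothesis — good reduction at `q` supplies exactly the separability Dedekind–Kummer would need:

* §1 `discr_uCubic_eq`: `disc(u³ + b₂u² + 8b₄u + 16b₆) = 256·Δ` (any ring); `dvd_discr_of_congr_cube`: a cubic `≡ (X − m)³ (mod q)` has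
  `q ∣ disc`.
* §2 **`exists_sub_intCast_mem_span_of_isPrime`** — `F` cubic, `q𝓞_F` prime, `η ∈ 𝓞_F` a root of a monic integer cubic `g` that HAS a root
  mod `q` ⟹ `η ≡ m (mod q𝓞_F)` for an integer `m`: `k = 𝓞_F/q𝓞_F` is a field with `[k : 𝔽_q] = 3` (`Ideal.finrank_quotient_map`), the degree of
  `η̄` over `𝔽_q` divides `3` (tower law) and is not `3` (else its minimal polynomial is `ḡ`, an irreducible cubic with a root), so it is `1`.
* §3 **`cubic_congr_cube_of_sub_intCast_mem_span`** — if moreover `g` is irreducible over `ℚ`, then `g ≡ (X − m)³ (mod q)`: `β = (η − m)/q ∈ 𝓞_F`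
  generates `ℚ(η)` (`ℚ⟮β⟯ = ℚ⟮η⟯`), its minimal polynomial `h ∈ ℤ[X]` (`minpoly.isIntegrallyClosed_eq_field_fractions'`) is a monic cubic with
  `g(qX + m) = q³·h(X)`, and comparing coefficients gives `b ≡ −3m`, `c ≡ 3m²`, `d ≡ −m³`.
* §4 **`odd_frobeniusTrace_of_isInertIn`** — `W/ℚ` globally minimal elliptic with `E(ℚ)[2] = 0`, `F` a cubic `2`-division field, `q` odd,
  `q ∤ Δ_min`, `q` inert in `F` ⟹ `a_q(W)` odd: otherwise the reduced `2`-division cubic has a root mod `q`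
  (`TwoAdicTwistConverse.odd_frobeniusTrace_iff_forall_ne_zero`), §2–§3 apply to the `u`-cubic and its integral root `η = 4θ`
  (`U2.exists_integral_root_twoDivisionMonic`), and `q ∣ 256·Δ_min` — impossible. **`isInertIn_iff_odd_frobeniusTrace`** — the equivalence
  (with `U2.isInertIn_of_odd_frobeniusTrace`).

CONSEQUENCE FOR THE (T) PARTITION (D-0171): the Zhai class `T_Z` of a seed in the `IsInertIn` form (g23 `…TwistFamilyZhai*`) and in the `a_q`-odd
form (g24 `…TwistFamilyZhaiTransport*`, U2) is ONE class, kernel-checked; -data may tag members by LMFDB's `a_q` with no loss. Beyond-print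
theorem: no (textbook algebraic number theory; the point is that it is now in the kernel without Kummer–Dedekind's conductor hypothesis).
A librarian may re-home §2–§3 (pure number-field statements) under `Literature/NumberTheory/NumberFields`.

References: [Zhai2016] §1 («inert in the field F»); [Marcus2018] Ch. 3 Thms. 21, 27; [NeukirchANT1999] I (8.2)–(8.3); [SilvermanAEC2009] III.1,
III.2.3, VII.2; [KrizLi2019] Def. 4.1 (a_ℓ odd ⟺ Frob_ℓ of order 3).
-/

set_option autoImplicit false
set_option linter.dupNamespace false

noncomputable section

open scoped Classical Polynomial NumberField IntermediateField

open Polynomial WeierstrassCurve NumberField Module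
open Literature.NumberTheory.EllipticCurves Literature.NumberTheory.EllipticCurves.Zhai2016
open Summit.BirchSwinnertonDyer.Uniform

namespace Summit.BirchSwinnertonDyer.BirchSwinnertonDyer.Theorems.AlignedTransportAtTwoTwistFamilyZhaiInertConverse

/-! ## §1 Two discriminant identities -/

/-- The discriminant of the `u`-cubic `u³ + b₂u² + 8b₄u + 16b₆` (`= 16·ψ₂(u/4)`) is `256·Δ`. [cite: SilvermanAEC2009, III.1 (b-invariants, Δ)] -/
theorem discr_uCubic_eq {R : Type*} [CommRing R] (V : WeierstrassCurve R) :
    (⟨1, V.b₂, 8 * V.b₄, 16 * V.b₆⟩ : Cubic R).discr = 256 * V.Δ := by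
  simp only [Cubic.discr, WeierstrassCurve.Δ, WeierstrassCurve.b₂, WeierstrassCurve.b₄, WeierstrassCurve.b₆, WeierstrassCurve.b₈]
  ring

/-- A monic cubic congruent to a cube `(X − m)³` has discriminant `0`: if `b = −3m + q·r`, `c = 3m² + q·s`, `d = −m³ + q·t` then
`q ∣ discr ⟨1, b, c, d⟩`. [folklore] -/
theorem dvd_discr_of_congr_cube {R : Type*} [CommRing R] (q m r s t : R) :
    q ∣ (⟨1, -3 * m + q * r, 3 * m ^ 2 + q * s, -m ^ 3 + q * t⟩ : Cubic R).discr := by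
  simp only [Cubic.discr]
  exact ⟨(-27) * q * t ^ 2 + (-54) * q * m * s * t + (-27) * q * m ^ 2 * s ^ 2 + (-54) * q * m ^ 2 * r * t + (-54) * q * m ^ 3 * r * s
      + (-27) * q * m ^ 4 * r ^ 2 + (-4) * q ^ 2 * s ^ 3 + 18 * q ^ 2 * r * s * t + (-6) * q ^ 2 * m * r * s ^ 2 + 36 * q ^ 2 * m * r ^ 2 * t
      + 6 * q ^ 2 * m ^ 2 * r ^ 2 * s + 4 * q ^ 2 * m ^ 3 * r ^ 3 + q ^ 3 * r ^ 2 * s ^ 2 + (-4) * q ^ 3 * r ^ 3 * t, by ring⟩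

/-! ## §2 `q` inert in a cubic field: an integral root of a monic integer cubic with a root mod `q` is ≡ an integer mod `q𝓞_F` -/

/-- **In a cubic number field `F` with `q𝓞_F` prime, an algebraic integer `η` that is a root of a monic integer cubic `g` having a root
mod `q` satisfies `η ≡ m (mod q𝓞_F)` for some `m ∈ ℤ`.** `k = 𝓞_F/q𝓞_F` is a field of degree `3` over `𝔽_q` (fundamental identity,
`Ideal.finrank_quotient_map`); the degree of `η̄ ∈ k` over `𝔽_q` divides `3`; it is not `3`, because then its minimal polynomial would be
`ḡ` itself, an irreducible cubic — but `ḡ` has a root in `𝔽_q`; so it is `1`, i.e. `η̄ ∈ 𝔽_q`. [cite: Marcus2018, Ch. 3 Thm. 21 and Thm. 27]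
[cite: NeukirchANT1999, I (8.2)] -/
theorem exists_sub_intCast_mem_span_of_isPrime {F : Type*} [Field F] [NumberField F] (h3 : finrank ℚ F = 3)
    {q : ℕ} (hq : q.Prime) {g : ℤ[X]} (hg : g.Monic) (hdeg : g.natDegree = 3)
    (η : 𝓞 F) (hη : aeval η g = 0) (hprime : (Ideal.span {((q : ℤ) : 𝓞 F)}).IsPrime)
    {n : ℤ} (hn : (q : ℤ) ∣ g.eval n) :
    ∃ m : ℤ, η - (m : 𝓞 F) ∈ Ideal.span {((q : ℤ) : 𝓞 F)} := by
  -- `p = (q)`, `R₀ = ℤ/(q)`, `A = 𝓞_F / q𝓞_F`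
  set p : Ideal ℤ := Ideal.span {(q : ℤ)} with hp
  haveI hpmax : p.IsMaximal :=
    PrincipalIdealRing.isMaximal_of_irreducible (Nat.prime_iff_prime_int.mp hq).irreducible
  set I : Ideal (𝓞 F) := Ideal.map (algebraMap ℤ (𝓞 F)) p with hI
  have hIspan : I = Ideal.span {((q : ℤ) : 𝓞 F)} := by
    rw [hI, hp, Ideal.map_span, Set.image_singleton, eq_intCast]
  rw [← hIspan] at hprime ⊢
  letI : Field (ℤ ⧸ p) := Ideal.Quotient.field p
  -- `I` is maximal (a nonzero prime of a Dedekind domain), so `A` is a field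
  have hIbot : I ≠ ⊥ := by
    rw [hIspan, Ne, Ideal.span_singleton_eq_bot]
    exact_mod_cast hq.ne_zero
  haveI hImax : I.IsMaximal := hprime.isMaximal hIbot
  letI : Field (𝓞 F ⧸ I) := Ideal.Quotient.field I
  have hdimA : finrank (ℤ ⧸ p) (𝓞 F ⧸ I) = 3 := (Ideal.finrank_quotient_map p ℚ F).trans h3
  haveI : Module.Finite (ℤ ⧸ p) (𝓞 F ⧸ I) := Module.finite_of_finrank_pos (by omega)
  -- the reduced cubic `g₀` over `R₀`, its root `n̄`, and its root `η̄`
  set g₀ : (ℤ ⧸ p)[X] := g.map (algebraMap ℤ (ℤ ⧸ p)) with hg₀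
  have hg₀monic : g₀.Monic := hg.map _
  have hg₀deg : g₀.natDegree = 3 := by rw [hg₀, hg.natDegree_map, hdeg]
  have hn₀ : g₀.IsRoot (algebraMap ℤ (ℤ ⧸ p) n) := by
    rw [IsRoot, hg₀, eval_map, eval₂_hom, Ideal.Quotient.algebraMap_eq, Ideal.Quotient.eq_zero_iff_mem, hp,
      Ideal.mem_span_singleton]
    exact hn
  set ηb : 𝓞 F ⧸ I := Ideal.Quotient.mk I η with hηb
  have hrootη : aeval ηb g₀ = 0 := by
    rw [aeval_def, hg₀, eval₂_map]
    have h1 : (algebraMap (ℤ ⧸ p) (𝓞 F ⧸ I)).comp (algebraMap ℤ (ℤ ⧸ p)) =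
        (Ideal.Quotient.mk I).comp (algebraMap ℤ (𝓞 F)) := RingHom.ext_int _ _
    rw [h1, hηb, ← Polynomial.hom_eval₂, ← aeval_def, hη, map_zero]
  have hint : IsIntegral (ℤ ⧸ p) ηb := .of_finite (ℤ ⧸ p) ηb
  -- the degree of `η̄` over `R₀` divides `3` and is not `3`
  have hμdvd : minpoly (ℤ ⧸ p) ηb ∣ g₀ := minpoly.dvd _ _ hrootη
  have hK : finrank (ℤ ⧸ p) (ℤ ⧸ p)⟮ηb⟯ = (minpoly (ℤ ⧸ p) ηb).natDegree := IntermediateField.adjoin.finrank hint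
  have htower := Module.finrank_mul_finrank (ℤ ⧸ p) (↥(ℤ ⧸ p)⟮ηb⟯) (𝓞 F ⧸ I)
  rw [hK, hdimA] at htower
  have hdvd3 : (minpoly (ℤ ⧸ p) ηb).natDegree ∣ 3 := Dvd.intro _ htower
  have hμ1 : (minpoly (ℤ ⧸ p) ηb).natDegree = 1 := by
    rcases (Nat.dvd_prime Nat.prime_three).mp hdvd3 with h | h
    · exact h
    · exfalso
      have hμg : g₀ = minpoly (ℤ ⧸ p) ηb :=
        Polynomial.eq_of_monic_of_dvd_of_natDegree_le (minpoly.monic hint) hg₀monic hμdvd (by rw [h, hg₀deg])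
      have hirr : Irreducible g₀ := hμg ▸ minpoly.irreducible hint
      exact hirr.not_isRoot_of_natDegree_ne_one (by rw [hg₀deg]; decide) hn₀
  -- so `η̄` comes from `R₀`: `η ≡ m (mod q𝓞_F)` for an integer `m`
  obtain ⟨r, hr⟩ := minpoly.natDegree_eq_one_iff.mp hμ1
  obtain ⟨m, rfl⟩ := Ideal.Quotient.mk_surjective r
  refine ⟨m, ?_⟩
  rw [← Ideal.Quotient.eq, ← map_intCast (algebraMap ℤ (𝓞 F)) m, ← Ideal.Quotient.algebraMap_quotient_map_quotient]
  exact hr.symm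

/-! ## §3 `η ≡ m (mod q𝓞_F)` forces `g ≡ (X − m)³ (mod q)` -/

/-- The composite `g(qX + m)` of a monic cubic `g = X³ + bX² + cX + d` with the affine map `X ↦ qX + m`, as a cubic. [folklore] -/
theorem toPoly_comp_affine {R : Type*} [CommRing R] (b c d q m : R) :
    (Cubic.toPoly ⟨1, b, c, d⟩).comp (C q * X + C m) =
      Cubic.toPoly ⟨q ^ 3, 3 * q ^ 2 * m + b * q ^ 2, 3 * q * m ^ 2 + 2 * b * q * m + c * q, m ^ 3 + b * m ^ 2 + c * m + d⟩ := by
  simp only [Cubic.toPoly, add_comp, mul_comp, pow_comp, C_comp, X_comp, map_one, one_mul, C_add, C_mul, C_pow, C_ofNat]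
  ring

/-- `C u · (X³ + bX² + cX + d)` as a cubic. [folklore] -/
theorem C_mul_toPoly {R : Type*} [CommRing R] (u b c d : R) :
    C u * Cubic.toPoly ⟨1, b, c, d⟩ = Cubic.toPoly ⟨u, u * b, u * c, u * d⟩ := by
  simp only [Cubic.toPoly, map_one, one_mul, C_mul]
  ring

/-- **`η ≡ m (mod q𝓞_F)` forces `g ≡ (X − m)³ (mod q)`.** Let `g = X³ + bX² + cX + d ∈ ℤ[X]` be irreducible over `ℚ` with an integral root
`η ∈ 𝓞_F`, and suppose `η − m ∈ q𝓞_F` for an integer `m` and a prime `q`. Then `β = (η − m)/q ∈ 𝓞_F` generates `ℚ(η)`, so its minimal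
polynomial `h ∈ ℤ[X]` is a monic cubic with `g(qX + m) = q³·h(X)`; comparing coefficients, `b ≡ −3m`, `c ≡ 3m²`, `d ≡ −m³ (mod q)`.
[cite: Marcus2018, Ch. 2 (algebraic integers: minimal polynomial in ℤ[X]) and Ch. 3 Thm. 27] -/
theorem cubic_congr_cube_of_sub_intCast_mem_span {F : Type*} [Field F] [NumberField F]
    {q : ℕ} (hq : q.Prime) (P : Cubic ℤ) (hPa : P.a = 1) (hirr : Irreducible (P.toPoly.map (Int.castRingHom ℚ)))
    (η : 𝓞 F) (hη : aeval η P.toPoly = 0) {m : ℤ} (hm : η - (m : 𝓞 F) ∈ Ideal.span {((q : ℤ) : 𝓞 F)}) :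
    ∃ r s t : ℤ, P.b = -3 * m + q * r ∧ P.c = 3 * m ^ 2 + q * s ∧ P.d = -m ^ 3 + q * t := by
  obtain ⟨β, hβ⟩ := Ideal.mem_span_singleton'.mp hm
  have hq0 : (q : ℚ) ≠ 0 := by exact_mod_cast hq.ne_zero
  have hqF : (q : F) ≠ 0 := by exact_mod_cast hq.ne_zero
  -- in `F`: `η = q β + m`
  have hηO : η = ((q : ℤ) : 𝓞 F) * β + (m : 𝓞 F) := by linear_combination -hβ
  have hηF : ((η : 𝓞 F) : F) = (q : F) * (β : F) + (m : F) := by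
    rw [hηO]
    simp only [RingOfIntegers.coe_eq_algebraMap, map_add, map_mul, map_intCast, map_natCast, Int.cast_natCast]
  -- the rational cubic `gℚ` is the minimal polynomial of `η`
  set Pq : Cubic ℚ := P.map (Int.castRingHom ℚ) with hPq
  have hPq_toPoly : Pq.toPoly = P.toPoly.map (Int.castRingHom ℚ) := Cubic.map_toPoly
  have hPqa : Pq.a = 1 := by simp [hPq, Cubic.map, hPa]
  have hPq_eq : Pq = ⟨1, (P.b : ℚ), (P.c : ℚ), (P.d : ℚ)⟩ := by
    ext <;> simp [hPq, Cubic.map, hPa]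
  have hmonic : Pq.toPoly.Monic := Cubic.monic_of_a_eq_one hPqa
  have hirr' : Irreducible Pq.toPoly := by rwa [hPq_toPoly]
  have hηroot : aeval ((η : 𝓞 F) : F) Pq.toPoly = 0 := by
    rw [hPq_toPoly, ← algebraMap_int_eq, aeval_map_algebraMap, aeval_algebraMap_apply, hη, map_zero]
  have hminη : minpoly ℚ ((η : 𝓞 F) : F) = Pq.toPoly := (minpoly.eq_of_irreducible_of_monic hirr' hηroot hmonic).symm
  have hηint : IsIntegral ℚ ((η : 𝓞 F) : F) := .of_finite ℚ _
  have hβint : IsIntegral ℚ ((β : 𝓞 F) : F) := .of_finite ℚ _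
  -- `ℚ(β) = ℚ(η)`, so `β` has degree `3`
  have hKeq : ℚ⟮((β : 𝓞 F) : F)⟯ = ℚ⟮((η : 𝓞 F) : F)⟯ := by
    apply le_antisymm
    · rw [IntermediateField.adjoin_simple_le_iff]
      have h : ((β : 𝓞 F) : F) = (((η : 𝓞 F) : F) - (m : F)) * (q : F)⁻¹ := by
        rw [hηF]; field_simp; ring
      rw [h]
      exact mul_mem (sub_mem (IntermediateField.mem_adjoin_simple_self ℚ _) (intCast_mem _ m))
        (inv_mem (natCast_mem _ q))
    · rw [IntermediateField.adjoin_simple_le_iff, hηF]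
      exact add_mem (mul_mem (natCast_mem _ q) (IntermediateField.mem_adjoin_simple_self ℚ _)) (intCast_mem _ m)
  have hdegβ : (minpoly ℚ ((β : 𝓞 F) : F)).natDegree = 3 := by
    rw [← IntermediateField.adjoin.finrank hβint, (IntermediateField.equivOfEq hKeq).toLinearEquiv.finrank_eq,
      IntermediateField.adjoin.finrank hηint, hminη, Cubic.natDegree_of_a_ne_zero (by rw [hPqa]; exact one_ne_zero)]
  -- the integral minimal polynomial `h` of `β`, a monic cubic in `ℤ[X]`
  have hβZ : IsIntegral ℤ ((β : 𝓞 F) : F) := RingOfIntegers.isIntegral_coe β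
  set h : ℤ[X] := minpoly ℤ ((β : 𝓞 F) : F) with hh
  have hhmap : minpoly ℚ ((β : 𝓞 F) : F) = h.map (algebraMap ℤ ℚ) := minpoly.isIntegrallyClosed_eq_field_fractions' ℚ hβZ
  have hhmonic : h.Monic := minpoly.monic hβZ
  have hhdeg : h.natDegree = 3 := by rw [← hhmonic.natDegree_map (algebraMap ℤ ℚ), ← hhmap, hdegβ]
  obtain ⟨Q, hQ⟩ : ∃ Q : Cubic ℤ, Q.toPoly = h :=
    ⟨Cubic.equiv.symm ⟨h, by rw [degree_eq_natDegree hhmonic.ne_zero, hhdeg]; rfl⟩, congrArg Subtype.val (Cubic.equiv.apply_symm_apply _)⟩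
  have hQa : Q.a = 1 := by
    have h1 : h.leadingCoeff = 1 := hhmonic
    rw [Polynomial.leadingCoeff, hhdeg, ← hQ, Cubic.coeff_eq_a] at h1
    exact h1
  -- `g(qX + m)` is divisible by `minpoly ℚ β`, both of degree `3`
  set G : ℚ[X] := Pq.toPoly.comp (C (q : ℚ) * X + C (m : ℚ)) with hG
  have hGroot : aeval ((β : 𝓞 F) : F) G = 0 := by
    rw [hG, aeval_comp]
    simp only [map_add, map_mul, aeval_C, aeval_X, eq_ratCast, Rat.cast_natCast, Rat.cast_intCast]
    rw [← hηF]
    exact hηroot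
  have hGeq : G = Cubic.toPoly ⟨(q : ℚ) ^ 3, 3 * (q : ℚ) ^ 2 * m + (P.b : ℚ) * (q : ℚ) ^ 2,
      3 * (q : ℚ) * (m : ℚ) ^ 2 + 2 * (P.b : ℚ) * q * m + (P.c : ℚ) * q, (m : ℚ) ^ 3 + (P.b : ℚ) * (m : ℚ) ^ 2 + (P.c : ℚ) * m + P.d⟩ := by
    rw [hG, hPq_eq, toPoly_comp_affine]
  have hq3 : (q : ℚ) ^ 3 ≠ 0 := pow_ne_zero 3 hq0
  have hGdeg : G.natDegree = 3 := by rw [hGeq]; exact Cubic.natDegree_of_a_ne_zero hq3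
  have hGlc : G.leadingCoeff = (q : ℚ) ^ 3 := by rw [hGeq]; exact Cubic.leadingCoeff_of_a_ne_zero hq3
  have hGfac : G = C ((q : ℚ) ^ 3) * (h.map (algebraMap ℤ ℚ)) := by
    rw [← hGlc, ← hhmap]
    exact eq_leadingCoeff_mul_of_monic_of_dvd_of_natDegree_le (minpoly.monic hβint) (minpoly.dvd ℚ _ hGroot)
      (by rw [hGdeg, hdegβ])
  -- compare coefficients
  have hhQ : h.map (algebraMap ℤ ℚ) = Cubic.toPoly ⟨1, (Q.b : ℚ), (Q.c : ℚ), (Q.d : ℚ)⟩ := by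
    rw [← hQ, ← Cubic.map_toPoly]
    congr 1
    ext <;> simp [Cubic.map, hQa]
  rw [hhQ, C_mul_toPoly, hGeq] at hGfac
  have eb := Cubic.b_of_eq hGfac
  have ec := Cubic.c_of_eq hGfac
  have ed := Cubic.d_of_eq hGfac
  simp only at eb ec ed
  refine ⟨Q.b, q * Q.c - 2 * m * Q.b, (q : ℤ) ^ 2 * Q.d - Q.b * m ^ 2 - (q * Q.c - 2 * m * Q.b) * m, ?_, ?_, ?_⟩
  · have e : ((P.b : ℤ) : ℚ) = ((-3 * m + q * Q.b : ℤ) : ℚ) := by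
      push_cast
      have := mul_left_cancel₀ (pow_ne_zero 2 hq0) (a := (q : ℚ) ^ 2) (b := 3 * (m : ℚ) + P.b) (c := q * Q.b) (by linear_combination eb)
      linear_combination this
    exact_mod_cast e
  · have e : ((P.c : ℤ) : ℚ) = ((3 * m ^ 2 + q * (q * Q.c - 2 * m * Q.b) : ℤ) : ℚ) := by
      push_cast
      have e2 := mul_left_cancel₀ (pow_ne_zero 2 hq0) (a := (q : ℚ) ^ 2) (b := 3 * (m : ℚ) + P.b) (c := q * Q.b) (by linear_combination eb)
      have e1 := mul_left_cancel₀ hq0 (a := (q : ℚ)) (b := 3 * (m : ℚ) ^ 2 + 2 * P.b * m + P.c) (c := (q : ℚ) ^ 2 * Q.c)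
        (by linear_combination ec)
      linear_combination e1 - 2 * (m : ℚ) * e2
    exact_mod_cast e
  · have e : ((P.d : ℤ) : ℚ) = ((-m ^ 3 + q * ((q : ℤ) ^ 2 * Q.d - Q.b * m ^ 2 - (q * Q.c - 2 * m * Q.b) * m) : ℤ) : ℚ) := by
      push_cast
      have e2 := mul_left_cancel₀ (pow_ne_zero 2 hq0) (a := (q : ℚ) ^ 2) (b := 3 * (m : ℚ) + P.b) (c := q * Q.b) (by linear_combination eb)
      have e1 := mul_left_cancel₀ hq0 (a := (q : ℚ)) (b := 3 * (m : ℚ) ^ 2 + 2 * P.b * m + P.c) (c := (q : ℚ) ^ 2 * Q.c)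
        (by linear_combination ec)
      linear_combination ed - (m : ℚ) * e1 + (m : ℚ) ^ 2 * e2
    exact_mod_cast e

/-! ## §4 THE CONVERSE DICTIONARY: `q` inert in the cubic `2`-division field ⟹ `a_q` odd -/

/-- **INGREDIENTS F9, the converse half: `q` inert in `F` ⟹ `a_q(W)` odd.** For a globally minimal elliptic `W/ℚ` with `E(ℚ)[2] = 0`
(so the `2`-division cubic is irreducible), a cubic `2`-division field `F` (`Zhai2016.IsTwoDivisionField W F`), and an odd prime `q` of good
reduction (`q ∤ Δ_min`): if `q` is inert in `F` (`Zhai2016.IsInertIn F q`, `q𝓞_F` prime) then `a_q(W)` is odd. With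
`U2.isInertIn_of_odd_frobeniusTrace` this makes Zhai's printed twisting condition «`q` inert in `F`» and the cell's / LMFDB condition
«`a_q` odd» EQUIVALENT in the kernel. Proof: if `a_q` were even, the reduced `2`-division cubic has a root mod `q` (§ tree
`TwoAdicTwistConverse.odd_frobeniusTrace_iff_forall_ne_zero`), so the `u`-cubic `g` has a root mod `q`; by §2 its integral root `η = 4θ`
is `≡ m (mod q𝓞_F)`; by §3 `g ≡ (u − m)³ (mod q)`; so `q ∣ disc g = 256·Δ_min` (§1) — impossible for an odd good `q`. No index
(`q ∤ [𝓞_F : ℤ[η]]`) hypothesis is needed: good reduction supplies the separability that Dedekind–Kummer would ask for.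
[cite: Zhai2016, §1 (arXiv:1409.0231 chunk p0002 L18: «inert in the field F»)] [cite: Marcus2018, Ch. 3 Thm. 27] [cite: SilvermanAEC2009, III.2.3, VII.2] -/
theorem odd_frobeniusTrace_of_isInertIn (W : WeierstrassCurve ℚ) [W.IsElliptic] [W.IsGloballyMinimal]
    (hT : ∀ P : W.toAffine.Point, 2 • P = 0 → P = 0)
    {F : Type} [Field F] [NumberField F] (hF : IsTwoDivisionField W F)
    {q : ℕ} (hq : q.Prime) (hq2 : q ≠ 2) (hgood : ¬ (q : ℤ) ∣ minimalDiscriminantInt W) (hin : IsInertIn F q) :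
    Odd (W.frobeniusTrace q) := by
  haveI : Fact q.Prime := ⟨hq⟩
  obtain ⟨h3, θ, hθ⟩ := hF
  set M : WeierstrassCurve ℤ := integralModelInt W with hM
  obtain ⟨η, -, hη⟩ := U2.exists_integral_root_twoDivisionMonic W hθ
  have hprime : (Ideal.span {((q : ℤ) : 𝓞 F)}).IsPrime := hin
  -- the `b`'s of `W` are the integer `b`'s of `M`
  have hb₂ : W.b₂ = (M.b₂ : ℚ) := by
    conv_lhs => rw [← map_integralModelInt W]
    rw [map_b₂, eq_intCast]
  have hb₄ : W.b₄ = (M.b₄ : ℚ) := by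
    conv_lhs => rw [← map_integralModelInt W]
    rw [map_b₄, eq_intCast]
  have hb₆ : W.b₆ = (M.b₆ : ℚ) := by
    conv_lhs => rw [← map_integralModelInt W]
    rw [map_b₆, eq_intCast]
  -- the `u`-cubic is irreducible over `ℚ` (a rational root would be `4·x(T)` for a rational `2`-torsion point `T`)
  have hirr : Irreducible ((Cubic.toPoly ⟨1, M.b₂, 8 * M.b₄, 16 * M.b₆⟩).map (Int.castRingHom ℚ)) := by
    rw [← Cubic.map_toPoly]
    set Pq : Cubic ℚ := Cubic.map (Int.castRingHom ℚ) ⟨1, M.b₂, 8 * M.b₄, 16 * M.b₆⟩ with hPq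
    have hPqa : Pq.a = 1 := by simp [hPq, Cubic.map]
    have hne : Pq.toPoly ≠ 0 := Cubic.ne_zero_of_a_ne_zero (by rw [hPqa]; exact one_ne_zero)
    refine Polynomial.irreducible_of_degree_le_three_of_not_isRoot
      (by rw [Cubic.natDegree_of_a_ne_zero (by rw [hPqa]; exact one_ne_zero)]; decide) fun y hy => ?_
    have hy' : y ∈ Pq.roots := (mem_roots hne).mpr hy
    rw [Cubic.mem_roots_iff hne] at hy'
    simp only [hPq, Cubic.map, eq_intCast, Int.cast_mul, Int.cast_ofNat, Int.cast_one, one_mul] at hy'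
    have hx : 4 * (y / 4) ^ 3 + W.b₂ * (y / 4) ^ 2 + 2 * W.b₄ * (y / 4) + W.b₆ = 0 := by
      rw [hb₂, hb₄, hb₆]; linear_combination hy' / 16
    obtain ⟨T, hT0, hT2⟩ := U2.exists_ne_zero_two_nsmul_eq_zero_of_cubic_root W (by norm_num : (2 : ℚ) ≠ 0) hx
    exact hT0 (hT T hT2)
  -- the `a_q`-odd criterion: the reduced `2`-division cubic has no root mod `q`
  rw [TwoAdicTwistConverse.odd_frobeniusTrace_iff_forall_ne_zero W q hq2 (hasGoodReductionAtPrime_of_not_dvd W q hgood)]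
  intro x hx
  -- `y = 4x` is a root of `ḡ`; lift it to an integer `n`
  obtain ⟨n, hn⟩ := ZMod.intCast_surjective (4 * x)
  have hgn : (q : ℤ) ∣ (Cubic.toPoly ⟨1, M.b₂, 8 * M.b₄, 16 * M.b₆⟩).eval n := by
    rw [← ZMod.intCast_zmod_eq_zero_iff_dvd]
    simp only [Cubic.toPoly, eval_add, eval_mul, eval_pow, eval_C, eval_X, one_mul, Int.cast_add, Int.cast_mul, Int.cast_pow,
      Int.cast_ofNat, hn]
    linear_combination 16 * hx
  -- §2: `η ≡ m (mod q𝓞_F)`; §3: `g ≡ (u − m)³ (mod q)`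
  obtain ⟨m, hm⟩ := exists_sub_intCast_mem_span_of_isPrime h3 hq (Cubic.monic_of_a_eq_one rfl)
    (Cubic.natDegree_of_a_ne_zero one_ne_zero) η hη hprime hgn
  obtain ⟨r, s, t, hb, hc, hd⟩ := cubic_congr_cube_of_sub_intCast_mem_span hq ⟨1, M.b₂, 8 * M.b₄, 16 * M.b₆⟩ rfl hirr η hη hm
  dsimp only at hb hc hd
  -- §1: `q ∣ disc g = 256 · Δ_min`
  have hdisc : (q : ℤ) ∣ 256 * M.Δ := by
    rw [← discr_uCubic_eq M, hb, hc, hd]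
    exact dvd_discr_of_congr_cube _ _ _ _ _
  -- `q` is an odd prime not dividing `Δ_min = Δ(M)`: contradiction
  have hqΔ : ¬ (q : ℤ) ∣ M.Δ := hgood
  rcases (Nat.prime_iff_prime_int.mp hq).dvd_or_dvd hdisc with h | h
  · have h' : q ∣ 2 ^ 8 := by exact_mod_cast h
    exact hq2 ((Nat.prime_dvd_prime_iff_eq hq Nat.prime_two).mp (hq.dvd_of_dvd_pow h'))
  · exact hqΔ h

/-- **THE DICTIONARY IS AN EQUIVALENCE.** For a globally minimal elliptic `W/ℚ` with `E(ℚ)[2] = 0`, a cubic `2`-division field `F`, and an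
odd prime `q` of good reduction: `q` is inert in `F` iff `a_q(W)` is odd (`⟸`: `U2.isInertIn_of_odd_frobeniusTrace`; `⟹`: above).
[cite: Zhai2016, §1 (arXiv:1409.0231 chunk p0002 L18)] [cite: KrizLi2019, Def. 4.1 (a_ℓ odd ⟺ Frob_ℓ of order 3)] -/
theorem isInertIn_iff_odd_frobeniusTrace (W : WeierstrassCurve ℚ) [W.IsElliptic] [W.IsGloballyMinimal]
    (hT : ∀ P : W.toAffine.Point, 2 • P = 0 → P = 0)
    {F : Type} [Field F] [NumberField F] (hF : IsTwoDivisionField W F)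
    {q : ℕ} (hq : q.Prime) (hq2 : q ≠ 2) (hgood : ¬ (q : ℤ) ∣ minimalDiscriminantInt W) :
    IsInertIn F q ↔ Odd (W.frobeniusTrace q) :=
  ⟨odd_frobeniusTrace_of_isInertIn W hT hF hq hq2 hgood, U2.isInertIn_of_odd_frobeniusTrace W hF hq hq2 hgood⟩

end Summit.BirchSwinnertonDyer.BirchSwinnertonDyer.Theorems.AlignedTransportAtTwoTwistFamilyZhaiInertConverse

end
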